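import Mathlib.Combinatorics.SimpleGraph.Coloring.Vertex
import Mathlib.Combinatorics.SimpleGraph.DegreeSum
import Mathlib.Algebra.Order.BigOperators.Group.Finset
import Mathlib.Algebra.BigOperators.Ring.Finset
import Mathlib.Data.Real.Basic
import Mathlib.Tactic.Linarith
import Mathlib.Tactic.NormNum
import Mathlib.Tactic.Ring
import HarnessLib

/-!
# Nonlocal games: the classical value is attained by a deterministic strategy; CHSH; graph-colouring games

Topic `Literature/Computability/QuantumComplexity`.  Sources:

* R. Cleve, P. Høyer, B. Toner, J. Watrous, *Consequences and limits of nonlocal strategies*,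
  Proc. 19th IEEE Conference on Computational Complexity (2004) 236–249 = arXiv:quant-ph/0404076
  [CleveEtAl2004] (held text `paper:arxiv-quant-ph_0404076`), §2 p. 4: “Let π be a probability
  distribution on S × T, and let V be a predicate on S × T × A × B … A deterministic strategy is a
  restricted type of classical strategy in which a and b are simply functions of s and t,
  respectively. The classical value of a game is always obtained by some deterministic strategy
  given that any probabilistic strategy can be expressed as a convex combination of deterministic
  strategies. In other words, ω_c(G(V,π)) = max_{a,b} Σ_{s,t} π(s,t) V(a(s), b(t) | s, t)”;
  §3.1 p. 5: “Let S = T = A = B = {0,1}, let π be the uniform distribution on S × T, and let V be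
  the predicate V(a,b|s,t) = 1 if a ⊕ b = s ∧ t … The classical value of the game is
  ω_c(G) = 3/4, which is easily verified by considering all deterministic strategies.”
* P. J. Cameron, A. Montanaro, M. W. Newman, S. Severini, A. Winter, *On the quantum chromatic
  number of a graph*, Electron. J. Combin. 14 (2007) R81 = arXiv:quant-ph/0608016 [CameronEtAl2007]
  (held text `paper:arxiv-quant-ph_0608016`), §1 p. 3: “they each get asked a vertex v, w of the
  graph, respectively and have to report back a colour α, β … if v = w, then to pass they have to
  reply the same: α = β; if vw ∈ E, then to pass they have to reply differently: α ≠ β … they can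
  pass with probability 1 if and only if c ≥ χ(G), the chromatic number of G – that is, in a
  classical world where Alice and Bob may share randomness and an otherwise deterministic
  strategy.”
* A. T. Than et al., *Nonlocal games as cross-platform quantum benchmarks*, arXiv:2603.18323v1
  [ThanEtAl2026] (held text `paper:arxiv-2603.18323`), §1.2 p. 6 (vertex questions (v,v), edge
  questions (u,v), uv ∈ E), §3 eq. (4) p. 7: “ω = (1/88)(Σ_{j∈vertex} p_j + 2 Σ_{j∈edge} p_j)” and
  “The classical game value under this distribution is ω_c = 86/88 ≈ 0.977: the optimal
  classical strategy … winning all 14 vertex questions deterministically and winning only 72 of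
  the 74 directed edge questions, failing on the single edge whose endpoints share a color
  … (1 − ω_c = 2/88).”

HONEST FRAMING (pub-qadeq lane context, CLAIMS row E-76 — a trapped-ion win rate 0.982(3)
against the classical value ω_c = 86/88 of the G14 colouring game): instance-level adjudication
of specific advantage claims; no claim about BQP vs BPP or the summit.  This file is vocabulary
for what such a ‘classical bound’ IS: a maximum over deterministic strategies (shared
randomness cannot exceed it), the CHSH value 3/4, and for graph-colouring games the facts that a
perfect classical strategy exists iff the graph is c-colourable and that otherwise EVERY
deterministic strategy loses at least two of the |V| + 2|E| directed questions — the shape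
`1 − ω_c = 2/88` of the E-76 threshold.  Nothing here concerns quantum strategies, devices,
the no-signalling assumption, or the particular graph G14 (its adjacency and chromatic number
are not formalised).

## Contents (all proved, 0 named facts)

* `NonlocalGame S T A B` (nonnegative question weights `π`, Boolean predicate `V`), `detValue`
  (`Σ_{s,t} π(s,t) V(a(s),b(t)|s,t)`), `classicalValue` (the max over deterministic strategies),
  `detValue_le_classicalValue`, `exists_detValue_eq_classicalValue`,
  **`mixedValue_le_classicalValue`** (a convex combination of deterministic strategies — shared
  randomness — does not exceed the classical value).
* `chsh` and **`classicalValue_chsh : chsh.classicalValue = 3/4`**.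
* `coloringGame G c` (weight 1 on each vertex question `(v,v)` and each directed edge question
  `(u,v)`, `G.Adj u v`; answers in `Fin c`), `coloringQuestions`, **`card_coloringQuestions`**
  (`|V| + 2|E|` questions), `detValue_coloringGame` (= number of questions won),
  **`exists_perfect_of_colorable`** / **`colorable_of_perfect`** (CMNSSW: perfect classical
  strategy iff c ≥ χ(G)), **`two_le_card_losses_of_not_colorable`** (¬ c-colourable ⇒ every
  deterministic strategy loses ≥ 2 directed questions), `detValue_coloringGame_le`
  (value ≤ |V| + 2|E| − 2) and `card_losses_eq_two_of_unique_monochromatic` (a colour assignment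
  with exactly one monochromatic edge loses exactly the two orientations of that edge — the
  optimal-strategy shape “86/88”).
-/

namespace Literature.Computability.QuantumComplexity

open Finset

/-- A **nonlocal game** `G = G(V, π)` on finite question sets `S, T` and answer sets `A, B`:
nonnegative question weights `π(s,t)` (the referee's distribution; normalisation is not
imposed — every statement below is homogeneous in `π`) and the winning predicate
`V(a, b | s, t)`. [cite: CleveEtAl2004, §2 (Nonlocal games)] -/
structure NonlocalGame (S T A B : Type*) where
  /-- the question weights `π(s,t) ≥ 0` -/
  prior : S → T → ℝ
  /-- nonnegativity of the weights -/
  prior_nonneg : ∀ s t, 0 ≤ prior s t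
  /-- the predicate `V(a, b | s, t)` -/
  win : S → T → A → B → Bool

namespace NonlocalGame

variable {S T A B : Type*} [Fintype S] [Fintype T]

/-- The winning weight of the DETERMINISTIC strategy `(a, b)` (“a and b are simply functions of
s and t”): `Σ_{s,t} π(s,t) V(a(s), b(t) | s, t)`. [cite: CleveEtAl2004, §2 (Classical strategies and classical values)] -/
def detValue (G : NonlocalGame S T A B) (a : S → A) (b : T → B) : ℝ :=
  ∑ s, ∑ t, G.prior s t * (if G.win s t (a s) (b t) then 1 else 0)

/-- A deterministic strategy wins at most the total weight. [cite: CleveEtAl2004, §2] -/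
theorem detValue_le_sum_prior (G : NonlocalGame S T A B) (a : S → A) (b : T → B) :
    G.detValue a b ≤ ∑ s, ∑ t, G.prior s t := by
  unfold detValue
  refine sum_le_sum fun s _ => sum_le_sum fun t _ => ?_
  have := G.prior_nonneg s t
  split_ifs <;> nlinarith

/-- … and at least nothing. [cite: CleveEtAl2004, §2] -/
theorem detValue_nonneg (G : NonlocalGame S T A B) (a : S → A) (b : T → B) :
    0 ≤ G.detValue a b := by
  unfold detValue
  refine sum_nonneg fun s _ => sum_nonneg fun t _ => ?_
  have := G.prior_nonneg s t
  split_ifs <;> nlinarith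

variable [DecidableEq S] [DecidableEq T] [Fintype A] [Fintype B] [Nonempty A] [Nonempty B]

/-- **The classical value** `ω_c(G(V,π)) = max_{a,b} Σ_{s,t} π(s,t) V(a(s), b(t) | s, t)`, the
maximum over all deterministic strategies `a : S → A`, `b : T → B`.
[cite: CleveEtAl2004, §2 (display defining ω_c)] -/
noncomputable def classicalValue (G : NonlocalGame S T A B) : ℝ :=
  (univ : Finset ((S → A) × (T → B))).sup' univ_nonempty fun ab => G.detValue ab.1 ab.2

/-- Every deterministic strategy is bounded by the classical value. [cite: CleveEtAl2004, §2] -/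
theorem detValue_le_classicalValue (G : NonlocalGame S T A B) (a : S → A) (b : T → B) :
    G.detValue a b ≤ G.classicalValue :=
  le_sup' (f := fun ab : (S → A) × (T → B) => G.detValue ab.1 ab.2) (mem_univ (a, b))

/-- “The classical value of a game is always obtained by some deterministic strategy.”
[cite: CleveEtAl2004, §2] -/
theorem exists_detValue_eq_classicalValue (G : NonlocalGame S T A B) :
    ∃ a : S → A, ∃ b : T → B, G.detValue a b = G.classicalValue := by
  obtain ⟨ab, _, hab⟩ := exists_mem_eq_sup' (s := (univ : Finset ((S → A) × (T → B))))
    univ_nonempty fun ab => G.detValue ab.1 ab.2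
  exact ⟨ab.1, ab.2, hab.symm⟩

/-- An upper bound valid for every deterministic strategy bounds the classical value.
[cite: CleveEtAl2004, §2] -/
theorem classicalValue_le {G : NonlocalGame S T A B} {c : ℝ}
    (h : ∀ (a : S → A) (b : T → B), G.detValue a b ≤ c) : G.classicalValue ≤ c :=
  sup'_le _ _ fun ab _ => h ab.1 ab.2

/-- **Shared randomness cannot help**: a probabilistic classical strategy — a convex combination
(weights `w i ≥ 0`, `Σ w = 1`, the shared random string `i`) of deterministic strategies — wins
with probability at most `ω_c` (“any probabilistic strategy can be expressed as a convex
combination of deterministic strategies”). [cite: CleveEtAl2004, §2] -/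
theorem mixedValue_le_classicalValue (G : NonlocalGame S T A B) {ι : Type*} (I : Finset ι)
    (w : ι → ℝ) (hw0 : ∀ i ∈ I, 0 ≤ w i) (hw1 : ∑ i ∈ I, w i = 1)
    (a : ι → S → A) (b : ι → T → B) :
    ∑ i ∈ I, w i * G.detValue (a i) (b i) ≤ G.classicalValue := by
  calc ∑ i ∈ I, w i * G.detValue (a i) (b i)
      ≤ ∑ i ∈ I, w i * G.classicalValue :=
        sum_le_sum fun i hi =>
          mul_le_mul_of_nonneg_left (G.detValue_le_classicalValue _ _) (hw0 i hi)
    _ = G.classicalValue := by rw [← sum_mul, hw1, one_mul]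

end NonlocalGame

/-! ## The CHSH game: `ω_c = 3/4` -/

/-- **The CHSH game**: `S = T = A = B = {0,1}`, `π` uniform on `S × T`, and
`V(a,b|s,t) = 1 iff a ⊕ b = s ∧ t`. [cite: CleveEtAl2004, §3.1] -/
noncomputable def chsh : NonlocalGame Bool Bool Bool Bool where
  prior _ _ := 1 / 4
  prior_nonneg _ _ := by norm_num
  win s t a b := (xor a b) == (s && t)

/-- Every deterministic CHSH strategy wins at most 3 of the 4 question pairs: `detValue ≤ 3/4`
(“easily verified by considering all deterministic strategies”). [cite: CleveEtAl2004, §3.1] -/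
theorem chsh_detValue_le (a b : Bool → Bool) : chsh.detValue a b ≤ 3 / 4 := by
  -- a strategy `Bool → Bool` is its pair of values
  have ha : a = fun s => cond s (a true) (a false) := by funext s; cases s <;> rfl
  have hb : b = fun t => cond t (b true) (b false) := by funext t; cases t <;> rfl
  rw [ha, hb]
  generalize a true = a₁; generalize a false = a₀; generalize b true = b₁; generalize b false = b₀
  cases a₀ <;> cases a₁ <;> cases b₀ <;> cases b₁ <;>
    norm_num [NonlocalGame.detValue, chsh, Fintype.sum_bool]

/-- The constant strategy `a = b = 0` wins exactly when `s ∧ t = 0`: value `3/4`.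
[cite: CleveEtAl2004, §3.1] -/
theorem chsh_detValue_const : chsh.detValue (fun _ => false) (fun _ => false) = 3 / 4 := by
  norm_num [NonlocalGame.detValue, chsh, Fintype.sum_bool]

/-- **`ω_c(CHSH) = 3/4`.** [cite: CleveEtAl2004, §3.1 (“The classical value of the game is ω_c(G) = 3/4”)] -/
theorem classicalValue_chsh : chsh.classicalValue = 3 / 4 :=
  le_antisymm (NonlocalGame.classicalValue_le chsh_detValue_le)
    (chsh_detValue_const ▸ chsh.detValue_le_classicalValue _ _)

/-! ## Graph-colouring games -/

section Coloring

variable {V : Type*} [Fintype V] [DecidableEq V] (G : SimpleGraph V) [DecidableRel G.Adj] (c : ℕ)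

/-- The rule of the **graph-colouring game** with `c` colours on the question `(u, v)`:
“if v = w, then to pass they have to reply the same: α = β; if vw ∈ E, then to pass they have
to reply differently: α ≠ β”. [cite: CameronEtAl2007, §1] -/
def coloringRule (q : V × V) (α β : Fin c) : Prop := (q.1 = q.2 → α = β) ∧ (G.Adj q.1 q.2 → α ≠ β)

/-- The rule is decidable (plumbing for the finite counts below). [folklore] -/
instance coloringRule.decidable (q : V × V) (α β : Fin c) :
    Decidable (coloringRule G c q α β) := by
  unfold coloringRule; infer_instance

/-- The questions actually asked: the vertex questions `(v, v)` and the DIRECTED edge questions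
`(u, v)`, `uv ∈ E` (“(x, y) ∼ (I_A, I_B) = {(v,v) | v ∈ V} ∪ {(u,v) | uv ∈ E}”, each undirected
edge in both orders — “74 directed edge questions” for the 37 edges of G14).
[cite: ThanEtAl2026, §1.2 and §3 eq. (4)] -/
def coloringQuestions : Finset (V × V) := univ.filter fun q => q.1 = q.2 ∨ G.Adj q.1 q.2

/-- **The graph-colouring game as a nonlocal game**: weight `1` on each vertex question and on
each directed edge question (the distribution of eq. (4), “ω = (1/88)(Σ_vertex p_j +
2 Σ_edge p_j)”, up to the normalisation `1/88 = 1/(|V| + 2|E|)`), answers in `[c] = Fin c`,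
predicate `coloringRule`. [cite: ThanEtAl2026, §3 eq. (4)] -/
noncomputable def coloringGame : NonlocalGame V V (Fin c) (Fin c) where
  prior u v := if u = v ∨ G.Adj u v then 1 else 0
  prior_nonneg u v := by split_ifs <;> norm_num
  win u v α β := decide (coloringRule G c (u, v) α β)

/-- The questions a deterministic strategy `(f, g)` LOSES. [cite: ThanEtAl2026, §3 (“failing on the single edge …”)] -/
def losses (f g : V → Fin c) : Finset (V × V) :=
  (coloringQuestions G).filter fun q => ¬ coloringRule G c q (f q.1) (g q.2)

/-- The questions a deterministic strategy `(f, g)` WINS. [cite: ThanEtAl2026, §3] -/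
def wins (f g : V → Fin c) : Finset (V × V) :=
  (coloringQuestions G).filter fun q => coloringRule G c q (f q.1) (g q.2)

/-- **`|V| + 2|E|` questions** (“14 vertex questions … 74 directed edge questions”, 88 in all
for G14). [cite: ThanEtAl2026, §3 eq. (4)] -/
theorem card_coloringQuestions :
    (coloringQuestions G).card = Fintype.card V + 2 * G.edgeFinset.card := by
  unfold coloringQuestions
  have hdiag : (univ.filter fun q : V × V => q.1 = q.2) = (univ : Finset V).diag := by
    ext q; simp [Finset.mem_diag]
  have hadj : (univ.filter fun q : V × V => G.Adj q.1 q.2).card = 2 * G.edgeFinset.card := by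
    rw [SimpleGraph.two_mul_card_edgeFinset]
  rw [filter_or, card_union_of_disjoint, hdiag, diag_card, card_univ, hadj]
  exact disjoint_filter.2 fun q _ h hq => G.irrefl (h ▸ hq)

/-- Wins and losses partition the questions. [cite: ThanEtAl2026, §3] -/
theorem card_wins_add_card_losses (f g : V → Fin c) :
    (wins G c f g).card + (losses G c f g).card = (coloringQuestions G).card :=
  card_filter_add_card_filter_not _

/-- With unit weights the value of a deterministic strategy is the NUMBER of questions it wins.
[cite: ThanEtAl2026, §3 eq. (4)] -/
theorem detValue_coloringGame (f g : V → Fin c) :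
    (coloringGame G c).detValue f g = (wins G c f g).card := by
  have hpt : ∀ q : V × V, (coloringGame G c).prior q.1 q.2 *
      (if (coloringGame G c).win q.1 q.2 (f q.1) (g q.2) then 1 else 0) =
      if q ∈ wins G c f g then (1 : ℝ) else 0 := by
    intro q
    simp only [coloringGame, wins, coloringQuestions, mem_filter, mem_univ, true_and,
      decide_eq_true_eq, Prod.mk.eta]
    by_cases h1 : q.1 = q.2 ∨ G.Adj q.1 q.2 <;>
      by_cases h2 : coloringRule G c q (f q.1) (g q.2) <;> simp [h1, h2]
  have key : (coloringGame G c).detValue f g =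
      ∑ q : V × V, (coloringGame G c).prior q.1 q.2 *
        (if (coloringGame G c).win q.1 q.2 (f q.1) (g q.2) then 1 else 0) := by
    unfold NonlocalGame.detValue
    exact (Fintype.sum_prod_type' (f := fun s t => (coloringGame G c).prior s t *
      (if (coloringGame G c).win s t (f s) (g t) then (1 : ℝ) else 0))).symm
  rw [key]
  simp_rw [hpt]
  rw [Finset.sum_boole, Finset.filter_mem_eq_inter, Finset.univ_inter]

/-- **A `c`-colouring is a perfect classical strategy** (both players answer with the colouring):
no question is lost. [cite: CameronEtAl2007, §1 (“they can pass with probability 1 if … c ≥ χ(G)”)] -/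
theorem exists_perfect_of_colorable (h : G.Colorable c) :
    ∃ f g : V → Fin c, losses G c f g = ∅ := by
  obtain ⟨C⟩ := h
  refine ⟨C, C, filter_eq_empty_iff.2 fun q _ hq => hq ⟨fun h => by rw [h], fun hadj => ?_⟩⟩
  exact C.valid hadj

/-- **A perfect classical strategy is a `c`-colouring** (Alice's answer map is proper: for
`uv ∈ E`, the vertex question `(v,v)` forces `g(v) = f(v)` and the edge question `(u,v)` forces
`f(u) ≠ g(v)`). [cite: CameronEtAl2007, §1 (“… only if c ≥ χ(G)”)] -/
theorem colorable_of_perfect {f g : V → Fin c} (h : losses G c f g = ∅) : G.Colorable c := by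
  have hwin : ∀ q ∈ coloringQuestions G, coloringRule G c q (f q.1) (g q.2) := by
    intro q hq
    by_contra hn
    have : q ∈ losses G c f g := mem_filter.2 ⟨hq, hn⟩
    rw [h] at this
    exact absurd this (Finset.notMem_empty q)
  refine ⟨SimpleGraph.Coloring.mk f fun {u v} hadj hfuv => ?_⟩
  have hvv : g v = f v :=
    ((hwin (v, v) (mem_filter.2 ⟨mem_univ _, Or.inl rfl⟩)).1 rfl).symm
  exact (hwin (u, v) (mem_filter.2 ⟨mem_univ _, Or.inr hadj⟩)).2 hadj (hfuv.trans hvv.symm)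

/-- **CMNSSW's classical dichotomy**: a perfect deterministic strategy exists iff `c ≥ χ(G)`,
i.e. iff `G` is `c`-colourable. [cite: CameronEtAl2007, §1] -/
theorem exists_perfect_iff_colorable :
    (∃ f g : V → Fin c, losses G c f g = ∅) ↔ G.Colorable c :=
  ⟨fun ⟨_, _, h⟩ => colorable_of_perfect G c h, exists_perfect_of_colorable G c⟩

/-- **If `G` is not `c`-colourable, every deterministic strategy loses at least TWO directed
questions** (the shape `1 − ω_c = 2/88`): were at most one question lost, Alice's map `f` would
be a proper colouring — for an edge `uv` with `f(u) = f(v)` the pairs {`(v,v)`, `(u,v)`} and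
{`(u,u)`, `(v,u)`} each contain a lost question, and these are two distinct questions.
[cite: ThanEtAl2026, §3 (“failing on the single edge whose endpoints share a color … (1 − ω_c = 2/88)”)] -/
theorem two_le_card_losses_of_not_colorable (h : ¬ G.Colorable c) (f g : V → Fin c) :
    2 ≤ (losses G c f g).card := by
  by_contra hlt
  have h1 : (losses G c f g).card ≤ 1 := by omega
  rw [card_le_one] at h1
  -- membership in `losses`
  have memL : ∀ u v, (u = v ∨ G.Adj u v) → ¬ coloringRule G c (u, v) (f u) (g v) →
      (u, v) ∈ losses G c f g := fun u v hq hn =>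
    mem_filter.2 ⟨mem_filter.2 ⟨mem_univ _, hq⟩, hn⟩
  refine h ⟨SimpleGraph.Coloring.mk f fun {u v} hadj hfuv => ?_⟩
  have hne : u ≠ v := G.ne_of_adj hadj
  -- first lost question: (v,v) or (u,v)
  have hA : (v, v) ∈ losses G c f g ∨ (u, v) ∈ losses G c f g := by
    by_cases hvv : coloringRule G c (v, v) (f v) (g v)
    · refine Or.inr (memL u v (Or.inr hadj) fun hr => hr.2 hadj ?_)
      rw [hfuv]; exact hvv.1 rfl
    · exact Or.inl (memL v v (Or.inl rfl) hvv)
  -- second lost question: (u,u) or (v,u)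
  have hB : (u, u) ∈ losses G c f g ∨ (v, u) ∈ losses G c f g := by
    by_cases huu : coloringRule G c (u, u) (f u) (g u)
    · refine Or.inr (memL v u (Or.inr hadj.symm) fun hr => hr.2 hadj.symm ?_)
      rw [← hfuv]; exact huu.1 rfl
    · exact Or.inl (memL u u (Or.inl rfl) huu)
  -- but any two lost questions would coincide
  rcases hA with hA | hA <;> rcases hB with hB | hB
  · exact hne (Prod.mk.inj (h1 _ hA _ hB)).1.symm
  · exact hne (Prod.mk.inj (h1 _ hA _ hB)).2.symm
  · exact hne (Prod.mk.inj (h1 _ hA _ hB)).2.symm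
  · exact hne (Prod.mk.inj (h1 _ hA _ hB)).1

/-- Hence, for `G` not `c`-colourable, every deterministic strategy wins at most
`|V| + 2|E| − 2` of the `|V| + 2|E|` questions: `ω_c ≤ 1 − 2/(|V| + 2|E|)` under the
distribution of eq. (4) (for G14: `ω_c ≤ 86/88`). [cite: ThanEtAl2026, §3 eq. (4) and “(1 − ω_c = 2/88)”] -/
theorem detValue_coloringGame_le (h : ¬ G.Colorable c) (f g : V → Fin c) :
    (coloringGame G c).detValue f g + 2 ≤ Fintype.card V + 2 * G.edgeFinset.card := by
  rw [detValue_coloringGame]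
  have hsum := card_wins_add_card_losses G c f g
  have hq := card_coloringQuestions G
  have h2 := two_le_card_losses_of_not_colorable G c h f g
  have hnat : (wins G c f g).card + 2 ≤ Fintype.card V + 2 * G.edgeFinset.card := by omega
  exact_mod_cast hnat

variable {G c} in
/-- **The optimal-strategy shape “86/88”**: if both players answer with a colour assignment `f`
having exactly ONE monochromatic edge `u₀v₀`, they win every vertex question and lose exactly
the two orientations of that edge. [cite: ThanEtAl2026, §3 (“winning all 14 vertex questions deterministically and winning only 72 of the 74 directed edge questions, failing on the single edge whose endpoints share a color”)] -/
theorem card_losses_eq_two_of_unique_monochromatic (f : V → Fin c) {u₀ v₀ : V}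
    (hadj : G.Adj u₀ v₀) (hmono : f u₀ = f v₀)
    (huniq : ∀ u v, G.Adj u v → f u = f v → s(u, v) = s(u₀, v₀)) :
    (losses G c f f).card = 2 := by
  have hne : u₀ ≠ v₀ := G.ne_of_adj hadj
  suffices losses G c f f = {(u₀, v₀), (v₀, u₀)} by
    rw [this, card_pair fun h => hne (Prod.mk.inj h).1]
  ext ⟨u, v⟩
  rw [losses, mem_filter, coloringQuestions, mem_filter, mem_insert, mem_singleton]
  constructor
  · rintro ⟨⟨-, hq⟩, hl⟩
    -- a lost question is a directed edge question answered with equal colours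
    have huv : u ≠ v := by
      rintro rfl
      exact hl ⟨fun _ => rfl, fun had => absurd had G.irrefl⟩
    have hadj' : G.Adj u v := hq.resolve_left huv
    have hfeq : f u = f v := by
      by_contra hneq
      exact hl ⟨fun h => absurd h huv, fun _ => hneq⟩
    rcases Sym2.eq_iff.1 (huniq u v hadj' hfeq) with ⟨h1, h2⟩ | ⟨h1, h2⟩
    · exact Or.inl (Prod.ext h1 h2)
    · exact Or.inr (Prod.ext h1 h2)
  · rintro (h | h)
    · obtain ⟨rfl, rfl⟩ := Prod.mk.inj h
      exact ⟨⟨mem_univ _, Or.inr hadj⟩, fun hr => hr.2 hadj hmono⟩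
    · obtain ⟨rfl, rfl⟩ := Prod.mk.inj h
      exact ⟨⟨mem_univ _, Or.inr hadj.symm⟩, fun hr => hr.2 hadj.symm hmono.symm⟩

end Coloring

end Literature.Computability.QuantumComplexity
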